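import Summits.BirchSwinnertonDyer.BirchSwinnertonDyer.Theorems.LambdaTransportDoorIotaSymmetryLambdaTwo
import Summits.BirchSwinnertonDyer.BirchSwinnertonDyer.Theorems.LambdaTransportDoorTwistedLValueBridge
import Literature.NumberTheory.EllipticCurves.KatoRankBoundLevelZeroProofs
import Literature.NumberTheory.EllipticCurves.SkinnerUrban2014.ShaOrderOfMainConjectureProofs
import Literature.Barriers.BirchSwinnertonDyer.PAdicFunctionalEquationParityAnyPrimeProofs
import HarnessLib

/-!
# The `λ_p = 2` stratum at an ODD good ordinary prime: `P_E = T² + a(T+1)`, `L(E,1) = 0 ⟺ a = 0`, the conductor-`p^m` dictionary,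
# effective Rohrlich, and at `p = 3`: `L(E,χ₉,1) = 0 ⟺ a = 3` — so `L(E,1)` and `L(E,χ₉,1)` never vanish together

Cell bsd-rank2, seat p2, GEN 68, part K68-B (the odd-prime sibling of part K68-A `…Theorems.LambdaTransportDoorLambdaTwoStratumAtTwo`).
THEOREMS ONLY (no `def`, no `instance`, no notation, no `sorry`); Barrier-B1 honest: statements about `L`-VALUES, the ROOT NUMBER, the
ORDER OF VANISHING OF `L_p(E,T)` and the SHAPE of its distinguished polynomial — no rank is bounded from below, BSD is proved for no curve.
No named fact is displayed: integrality is not assumed — every statement is about a RATIONAL LIFT `ι L = c · L_p(E,T)`, `c ∈ ℚ_pˣ`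
(one exists for every good ordinary `p`: `p^k · L_p(E,T) ∈ Λ`, `memIwasawaRat_padicLFunction_holds`, MTT §I.12–13), and `λ(L)`
does not depend on the choice.

SETTING.  `p` an ODD prime, `E = W/ℚ` globally minimal and GOOD ORDINARY AT `p` (`hord`), `f` its newform (any level `N`),
`L ∈ Λ = ℤ_p⟦T⟧` with `ι L = c · L_p(f, α_E, T)`, `c ≠ 0`.

* §1 GENERIC: `dvd_iff_dvd_pfree` (a prime `q ∤ p` divides `L` iff it divides `pfree L`), `lift_ne_zero` (the order law `ord_T (ι g) = ord_T g` is the tree's `order_iwasawaToPowerSeries`).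
* §2 NO `λ` HYPOTHESIS: `X_dvd_iff_entireLFunction_one_eq_zero` (`T ∣ L ⟺ L(E,1) = 0`); ★ the CONDUCTOR-`p^m` DICTIONARY
  `twistedLValue_eq_zero_iff_dvd`: for `m ≥ 2` and `χ` even primitive of conductor `p^m` of `p`-power order,
  `L(E,χ,1) = 0 ⟺ Φ_{p^{m−1}}(1+T) ∣ L`; ★ EFFECTIVE ROHRLICH `twistedLValue_ne_zero_of_lam_lt`: `λ(L) < p^{m−2}(p−1) ⟹ L(E,χ,1) ≠ 0`.
* §3 THE `λ_p = 2` STRATUM (`hlam : λ(L) = 2`): `normalForm` `pfree L = (T² + a(T+1))·U`, `a ∈ pℤ_p` (GEN 67 D, odd `p`: ONE family);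
  `entireLFunction_one_eq_zero_iff : L(E,1) = 0 ⟺ a = 0`; ★ `order_padicLFunction_eq_zero_or_two`: `ord_T L_p(E,T) ∈ {0, 2}` and
  `= 2 ⟺ L(E,1) = 0` (the `p`-adic analytic rank on the stratum is `0` or EXACTLY `2`); `rootNumber_eq_one` (`w(E) = +1`, conductor level);
  `twistedLValue_ne_zero_of_five_le` (`p ≥ 5`: NO cyclotomic twist of `E` vanishes at `s = 1`); `p = 3`:
  `twistedLValue_ne_zero_of_conductor_ge_twentyseven`, ★ `twistedLValue_nine_eq_zero_iff : L(E,χ₉,1) = 0 ⟺ a = 3` and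
  ★★ `three_mutualExclusion`: `L(E,1) = 0 ⟹ L(E,χ₉,1) ≠ 0` — on the `λ₃ = 2` stratum a central zero forbids every cyclotomic twist zero.

NEW relative to the tree: `Rank1Residual/Iwasawa/LambdaInvariantZeros*` prove the cumulative budget INEQUALITY (`λ < r + φ ⟹ ≠ 0`) at
the Birch-sum level; here the per-conductor statements are EQUIVALENCES read off the normal form, for every curve on the stratum.
References: Mazur–Tate–Teitelbaum, Invent. Math. 84 (1986) §I.8 (8.6), §I.12–14, §I.17–18; Greenberg, LNM 1716 §5 (p. 181);
Washington, GTM 83 §7.1–7.2 (Thm. 7.3); Rohrlich, Invent. Math. 75 (1984), Theorem p. 409.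
-/

-- planner-bsd-rank2-p2-g68-0 (cell bsd-rank2, seat p2, GEN 68, part K68-B)
set_option linter.dupNamespace false
set_option autoImplicit false

noncomputable section

open scoped Classical MatrixGroups ModularForm NumberField

open PowerSeries CongruenceSubgroup WeierstrassCurve Literature.NumberTheory.EllipticCurves
  Literature.NumberTheory.EllipticCurves.ModularForms Literature.NumberTheory.EllipticCurves.IwasawaAlgebra
  Literature.NumberTheory.EllipticCurves.Rank1Residual Literature.NumberTheory.EllipticCurves.Rank1Residual.Typed
  Summit.BirchSwinnertonDyer.Rank1Residual.X1.MuLambda Summit.BirchSwinnertonDyer.Rank1Residual.X1.ParitySqueeze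
  Summit.BirchSwinnertonDyer.Rank1Residual.Iwasawa
  Summit.BirchSwinnertonDyer.BirchSwinnertonDyer.Theorems.DefectPrime
  Summit.BirchSwinnertonDyer.BirchSwinnertonDyer.Theorems.LambdaTransportDoorIotaSymmetryLambdaTwo
  Summit.BirchSwinnertonDyer.BirchSwinnertonDyer.Theorems.LambdaTransportDoorTwistedLValueBridge

namespace Summit.BirchSwinnertonDyer.BirchSwinnertonDyer.Theorems.LambdaTransportDoorLambdaTwoStratumOddPrime

variable {p : ℕ} [hp : Fact p.Prime]

/-! ## §1 Generic lemmas in `Λ = ℤ_p⟦T⟧` -/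

/-- For a prime `q ∈ Λ` dividing no `p^k`: `q ∣ L ⟺ q ∣ pfree L` (`L = p^{μ(L)}·pfree L`). [cite: Washington1997, §7.1] -/
theorem dvd_iff_dvd_pfree {q : IwasawaAlgebra p} (hq : Prime q) (hqC : ∀ k : ℕ, ¬ q ∣ C (((p : ℕ) : ℤ_[p]) ^ k))
    (L : IwasawaAlgebra p) : q ∣ L ↔ q ∣ pfree L := by
  refine ⟨fun h ↦ ?_, fun h ↦ ?_⟩
  · rw [eq_C_pow_mu_mul_pfree L] at h
    exact (hq.dvd_or_dvd h).resolve_left (hqC _)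
  · rw [eq_C_pow_mu_mul_pfree L]
    exact dvd_mul_of_dvd_right h _

/-- An element of positive `λ` divides no `p^k` (`λ(p^k) = 0`, `λ` is monotone under divisibility). [cite: Washington1997, §7.1] -/
theorem not_dvd_C_pow_of_lam_pos {q : IwasawaAlgebra p} (hq : 0 < lam q) (k : ℕ) : ¬ q ∣ C (((p : ℕ) : ℤ_[p]) ^ k) := by
  rintro ⟨r, hr⟩
  have hq0 : q ≠ 0 := by rintro rfl; exact C_pow_ne_zero k (by rw [hr, zero_mul])
  have hr0 : r ≠ 0 := by rintro rfl; exact C_pow_ne_zero k (by rw [hr, mul_zero])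
  have h := congrArg lam hr
  rw [lam_mul hq0 hr0] at h
  have h1 : lam (C (((p : ℕ) : ℤ_[p]) ^ k) : IwasawaAlgebra p) = 0 := by
    have := lam_C_pow_mul k (one_ne_zero (α := IwasawaAlgebra p))
    rw [mul_one] at this
    rw [this]
    exact lam_eq_zero_of_isUnit isUnit_one
  omega

/-- The layer prime `Φ_{p^{n+1}}(1+T)` divides no `p^k` (`λ = φ(p^{n+1}) > 0`). [cite: Washington1997, §7.1, §13.2] -/
theorem not_cyclotomic_comp_dvd_C_pow (n k : ℕ) :
    ¬ ((((Polynomial.cyclotomic (p ^ (n + 1)) ℤ_[p]).comp (Polynomial.X + 1) : Polynomial ℤ_[p])) : IwasawaAlgebra p) ∣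
      C (((p : ℕ) : ℤ_[p]) ^ k) :=
  not_dvd_C_pow_of_lam_pos (by rw [lam_coe_cyclotomic_comp]; exact Nat.totient_pos.mpr (pow_pos hp.out.pos _)) k

/-- A divisor of a non-zero `G ∈ Λ` has `λ ≤ λ(G)`. [cite: Washington1997, §7.1] -/
theorem lam_le_lam_of_dvd {F G : IwasawaAlgebra p} (hG : G ≠ 0) (h : F ∣ G) : lam F ≤ lam G := by
  obtain ⟨q, rfl⟩ := h
  rw [lam_mul (left_ne_zero_of_mul hG) (right_ne_zero_of_mul hG)]
  exact Nat.le_add_right _ _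

/-- `ord_T (c·φ) = ord_T φ` for a non-zero constant `c` (any domain of coefficients). [folklore] -/
theorem order_C_mul {R : Type*} [CommRing R] [IsDomain R] {c : R} (hc : c ≠ 0) (φ : R⟦X⟧) :
    (PowerSeries.C c * φ).order = φ.order := by
  have h0 : (PowerSeries.C c : R⟦X⟧).order = 0 := by
    simpa using PowerSeries.order_monomial_of_ne_zero 0 c hc
  rw [PowerSeries.order_mul, h0, zero_add]

/-- The integer-coefficient layer polynomial of part B equals the `ℤ_p`-coefficient one in `Λ`. [folklore] -/
theorem coe_map_cyclotomic_comp (n : ℕ) :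
    ((((Polynomial.cyclotomic (p ^ (n + 1)) ℤ).comp (Polynomial.X + 1)).map (Int.castRingHom ℤ_[p]) : Polynomial ℤ_[p]) :
        IwasawaAlgebra p) =
      ((((Polynomial.cyclotomic (p ^ (n + 1)) ℤ_[p]).comp (Polynomial.X + 1) : Polynomial ℤ_[p])) : IwasawaAlgebra p) := by
  rw [Polynomial.map_comp, Polynomial.map_cyclotomic, Polynomial.map_add, Polynomial.map_X, Polynomial.map_one]

section Elliptic

variable {W : WeierstrassCurve ℚ} [W.IsElliptic] [W.IsGloballyMinimal] {N : ℕ} [NeZero N] {f : CuspForm (Gamma0 N) 2}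

/-- A rational lift of `L_p(E,T)` is non-zero (`L_p(E,T) ≠ 0`, Rohrlich). [cite: RohrlichInventiones1984, Theorem (p. 409)] -/
theorem lift_ne_zero (hord : IsOrdinaryAt W p) (hf : IsNewformOf W f) {L : IwasawaAlgebra p} {c : ℚ_[p]} (hc : c ≠ 0)
    (hL : iwasawaToPowerSeries p L = PowerSeries.C c * padicLFunction f (unitRoot W p : ℚ_[p])) : L ≠ 0 := by
  intro h
  rw [h, map_zero, eq_comm, mul_eq_zero] at hL
  rcases hL with h1 | h1
  · exact hc (by simpa using congrArg PowerSeries.constantCoeff h1)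
  · exact padicLFunction_unitRoot_ne_zero hord hf h1

/-- **A rational lift exists for every good ordinary `p`**: `ι G = p^k · L_p(E,T)` (MTT §I.12–13).
[cite: MazurTateTeitelbaum1986Invent, §I.12–§I.13] -/
theorem exists_lift (hord : IsOrdinaryAt W p) (hf : IsNewformOf W f) :
    ∃ (k : ℕ) (G : IwasawaAlgebra p), iwasawaToPowerSeries p G =
      PowerSeries.C (((p : ℕ) : ℚ_[p]) ^ k) * padicLFunction f (unitRoot W p : ℚ_[p]) := by
  obtain ⟨k, G, hG⟩ := memIwasawaRat_padicLFunction_holds (W := W) (p := p) (f := f) hord hf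
  exact ⟨k, G, hG.symm⟩

/-! ## §2 The doors without a `λ` hypothesis -/

/-- **`T ∣ L ⟺ L(E,1) = 0`** for a rational lift `ι L = c·L_p(E,T)` (`ord_T ι L = ord_T L`; interpolation at the trivial character,
`1 ≤ ord_T L_p ⟺ L(E,1) = 0`). [cite: MazurTateTeitelbaum1986Invent, §I.14 (14.3)] -/
theorem X_dvd_iff_entireLFunction_one_eq_zero (hord : IsOrdinaryAt W p) (hf : IsNewformOf W f) {L : IwasawaAlgebra p}
    {c : ℚ_[p]} (hc : c ≠ 0) (hL : iwasawaToPowerSeries p L = PowerSeries.C c * padicLFunction f (unitRoot W p : ℚ_[p])) :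
    (PowerSeries.X : IwasawaAlgebra p) ∣ L ↔ W.entireLFunction 1 = 0 := by
  have hordL : L.order = (padicLFunction f (unitRoot W p : ℚ_[p])).order := by
    rw [← order_iwasawaToPowerSeries p L, hL, order_C_mul hc]
  rw [← one_le_order_padicLFunction_iff W p hord hf, ← hordL, PowerSeries.X_dvd_iff]
  constructor
  · intro h0
    refine PowerSeries.le_order L 1 fun i hi ↦ ?_
    have hi' : i < 1 := by exact_mod_cast hi
    obtain rfl : i = 0 := by omega
    rwa [PowerSeries.coeff_zero_eq_constantCoeff_apply]
  · intro h1
    have h := PowerSeries.coeff_of_lt_order 0 (lt_of_lt_of_le (by exact_mod_cast Nat.zero_lt_one) h1)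
    rwa [PowerSeries.coeff_zero_eq_constantCoeff_apply] at h

/-- ★ **THE CONDUCTOR-`p^m` DICTIONARY at an odd good ordinary `p`** (no `λ` hypothesis): for `m ≥ 2`, `χ` an even primitive
Dirichlet character mod `p^m` of `p`-power order, and `Lχ` any entire continuation of `L(f, χ, s)`:
**`Lχ(1) = 0 ⟺ Φ_{p^{m−1}}(1+T) ∣ L`** (GEN 67 B with `e₀ = 1`). [cite: MazurTateTeitelbaum1986Invent, §I.8 (8.6), §I.14 (14.3)] -/
theorem twistedLValue_eq_zero_iff_dvd (hp2 : p ≠ 2) (hord : IsOrdinaryAt W p) (hf : IsNewformOf W f) {L : IwasawaAlgebra p}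
    {c : ℚ_[p]} (hc : c ≠ 0) (hL : iwasawaToPowerSeries p L = PowerSeries.C c * padicLFunction f (unitRoot W p : ℚ_[p]))
    {m : ℕ} (hm : 2 ≤ m) (χ : DirichletCharacter ℂ (p ^ m)) (hχ : χ.IsPrimitive) (hχe : χ.Even) (hχo : ∃ j : ℕ, orderOf χ = p ^ j)
    {Lχ : ℂ → ℂ} (hLd : Differentiable ℂ Lχ) (hLχ : ∀ s : ℂ, 2 < s.re → Lχ s = twistedLSeries f χ s) :
    Lχ 1 = 0 ↔ ((((Polynomial.cyclotomic (p ^ (m - 1)) ℤ_[p]).comp (Polynomial.X + 1) : Polynomial ℤ_[p])) :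
      IwasawaAlgebra p) ∣ L := by
  have hce : cyclotomicExponent p = 1 := by rw [cyclotomicExponent, if_neg hp2]
  obtain ⟨n, rfl⟩ : ∃ n, m = n + 1 + cyclotomicExponent p := ⟨m - 2, by rw [hce]; omega⟩
  have hn : n + 1 + cyclotomicExponent p - 1 = n + 1 := by rw [hce]; rfl
  rw [hn, twistedLValue_eq_zero_iff_cyclotomic_comp_dvd hord hf hc hL n χ hχ hχe hχo hLd hLχ, coe_map_cyclotomic_comp]

/-- ★ **EFFECTIVE ROHRLICH at an odd good ordinary `p`** (no `λ = 2` hypothesis): if **`λ(L) < φ(p^{m−1}) = p^{m−2}(p−1)`** then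
**`L(E, χ, 1) ≠ 0`** for every even primitive `p`-power-order `χ` of conductor `p^m` (`m ≥ 2`) and every continuation.
[cite: RohrlichInventiones1984, Theorem (p. 409)] [cite: Washington1997, §7.1–7.2, Thm. 7.3] [cite: MazurTateTeitelbaum1986Invent, §I.14] -/
theorem twistedLValue_ne_zero_of_lam_lt (hp2 : p ≠ 2) (hord : IsOrdinaryAt W p) (hf : IsNewformOf W f) {L : IwasawaAlgebra p}
    {c : ℚ_[p]} (hc : c ≠ 0) (hL : iwasawaToPowerSeries p L = PowerSeries.C c * padicLFunction f (unitRoot W p : ℚ_[p]))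
    {m : ℕ} (hm : 2 ≤ m) (hlam : lam L < (p ^ (m - 1)).totient) (χ : DirichletCharacter ℂ (p ^ m)) (hχ : χ.IsPrimitive)
    (hχe : χ.Even) (hχo : ∃ j : ℕ, orderOf χ = p ^ j) {Lχ : ℂ → ℂ} (hLd : Differentiable ℂ Lχ)
    (hLχ : ∀ s : ℂ, 2 < s.re → Lχ s = twistedLSeries f χ s) : Lχ 1 ≠ 0 := by
  rw [Ne, twistedLValue_eq_zero_iff_dvd hp2 hord hf hc hL hm χ hχ hχe hχo hLd hLχ]
  intro h
  have hle := lam_le_lam_of_dvd (lift_ne_zero hord hf hc hL) h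
  obtain ⟨k, hk⟩ : ∃ k, m - 1 = k + 1 := ⟨m - 2, by omega⟩
  rw [hk, lam_coe_cyclotomic_comp] at hle
  rw [hk] at hlam
  omega

/-! ## §3 The `λ_p = 2` stratum -/

/-- ★ **NORMAL FORM ON THE `λ_p = 2` STRATUM, `p` odd**: `pfree L = (T² + a(T+1))·U`, `U ∈ Λˣ`, `a ∈ pℤ_p` (GEN 67 D: at odd `p` the
`ι`-symmetry leaves ONE family). [cite: MazurTateTeitelbaum1986Invent, §I.17] [cite: Washington1997, §7.1 Thm. 7.3] -/
theorem normalForm (hp2 : p ≠ 2) (hord : IsOrdinaryAt W p) (hf : IsNewformOf W f) {L : IwasawaAlgebra p} {c : ℚ_[p]} (hc : c ≠ 0)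
    (hL : iwasawaToPowerSeries p L = PowerSeries.C c * padicLFunction f (unitRoot W p : ℚ_[p])) (hlam : lam L = 2) :
    ∃ (a : ℤ_[p]) (U : ℤ_[p]⟦X⟧), IsUnit U ∧ a ∈ IsLocalRing.maximalIdeal ℤ_[p] ∧ pfree L = (X ^ 2 + C a * (X + 1)) * U :=
  normalForm_of_eq_padicLFunction_odd hp2 hord hf hL (lift_ne_zero hord hf hc hL) hlam

/-- **`L(E,1) = 0 ⟺ a = 0`** for `pfree L = (T² + a(T+1))·U`. [cite: MazurTateTeitelbaum1986Invent, §I.14 (14.3)] -/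
theorem entireLFunction_one_eq_zero_iff (hord : IsOrdinaryAt W p) (hf : IsNewformOf W f) {L : IwasawaAlgebra p} {c : ℚ_[p]}
    (hc : c ≠ 0) (hL : iwasawaToPowerSeries p L = PowerSeries.C c * padicLFunction f (unitRoot W p : ℚ_[p]))
    {a : ℤ_[p]} {U : ℤ_[p]⟦X⟧} (hfac : pfree L = (X ^ 2 + C a * (X + 1)) * U) (hU : IsUnit U) :
    W.entireLFunction 1 = 0 ↔ a = 0 := by
  have hfac' : pfree L = (X ^ 2 + C a * X + C a) * U := by rw [hfac]; ring
  rw [← X_dvd_iff_entireLFunction_one_eq_zero hord hf hc hL, dvd_iff_dvd_pfree X_prime (fun k hk ↦ ?_) L,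
    X_dvd_normalForm_iff hfac' hU]
  rw [X_dvd_iff, constantCoeff_C] at hk
  exact C_pow_ne_zero (p := p) k (by rw [hk, map_zero])

/-- ★ **`ord_T L_p(E,T) ∈ {0, 2}` ON THE STRATUM, AND `= 2 ⟺ L(E,1) = 0`** (`p` odd): the `p`-adic analytic rank of a curve on the
`λ_p = 2` stratum is `0` (`L(E,1) ≠ 0`) or EXACTLY `2` (`L(E,1) = 0`) — never `1`.  B1: a statement about `L_p` and `L(E,1)`; the
passage to `rank E(ℚ)` is the summit. [cite: MazurTateTeitelbaum1986Invent, §I.12, §I.14, §I.17] [cite: Washington1997, §7.1] -/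
theorem order_padicLFunction_eq_zero_or_two (hp2 : p ≠ 2) (hord : IsOrdinaryAt W p) (hf : IsNewformOf W f) {L : IwasawaAlgebra p}
    {c : ℚ_[p]} (hc : c ≠ 0) (hL : iwasawaToPowerSeries p L = PowerSeries.C c * padicLFunction f (unitRoot W p : ℚ_[p]))
    (hlam : lam L = 2) :
    (W.entireLFunction 1 ≠ 0 → (padicLFunction f (unitRoot W p : ℚ_[p])).order = 0) ∧
      (W.entireLFunction 1 = 0 → (padicLFunction f (unitRoot W p : ℚ_[p])).order = 2) := by
  obtain ⟨a, U, hU, ha, hfac⟩ := normalForm hp2 hord hf hc hL hlam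
  have hiff := entireLFunction_one_eq_zero_iff hord hf hc hL hfac hU
  have hordL : (padicLFunction f (unitRoot W p : ℚ_[p])).order = L.order := by
    rw [← order_iwasawaToPowerSeries p L, hL, order_C_mul hc]
  have hfacL : L = C (((p : ℕ) : ℤ_[p]) ^ mu L) * ((X ^ 2 + C a * (X + 1)) * U) := by rw [← hfac]; exact eq_C_pow_mu_mul_pfree L
  have hU0 : U.order = 0 := by
    refine le_antisymm (PowerSeries.order_le 0 ?_) bot_le
    rw [PowerSeries.coeff_zero_eq_constantCoeff]
    exact (PowerSeries.isUnit_iff_constantCoeff.mp hU).ne_zero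
  have hC0 : (C (((p : ℕ) : ℤ_[p]) ^ mu L) : IwasawaAlgebra p).order = 0 := by
    simpa using PowerSeries.order_monomial_of_ne_zero 0 (((p : ℕ) : ℤ_[p]) ^ mu L)
      (pow_ne_zero _ (by exact_mod_cast hp.out.ne_zero))
  rw [hordL]
  refine ⟨fun h1 ↦ ?_, fun h1 ↦ ?_⟩
  · have ha0 : a ≠ 0 := fun h ↦ h1 (hiff.mpr h)
    rw [hfacL, PowerSeries.order_mul, PowerSeries.order_mul, hC0, hU0, zero_add, add_zero]
    refine le_antisymm (PowerSeries.order_le 0 ?_) bot_le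
    simpa using ha0
  · obtain rfl : a = 0 := hiff.mp h1
    rw [hfacL, PowerSeries.order_mul, PowerSeries.order_mul, hC0, hU0, zero_add, add_zero, map_zero, zero_mul, add_zero,
      PowerSeries.order_X_pow]
    rfl

/-- **`w(E) = +1` on the `λ_p = 2` stratum, `p` odd** (conductor level): `w(E) = (−1)^{ord_T L_p(E,T)}` and `ord_T ∈ {0, 2}`.
(The tree's `even_lam_iff_rootNumber_eq_one` is the general parity law; this is its reading on the stratum.)
[cite: GreenbergLNM1716, §5 (p. 181)] [cite: MazurTateTeitelbaum1986Invent, §I.17–§I.18] -/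
theorem rootNumber_eq_one [NeZero (W.conductorNorm ℤ)] (hp2 : p ≠ 2) (hord : IsOrdinaryAt W p)
    {F : CuspForm (Gamma0 (W.conductorNorm ℤ)) 2} (hF : IsNewformOf W F) {L : IwasawaAlgebra p} {c : ℚ_[p]} (hc : c ≠ 0)
    (hL : iwasawaToPowerSeries p L = PowerSeries.C c * padicLFunction F (unitRoot W p : ℚ_[p])) (hlam : lam L = 2) :
    W.rootNumber = 1 := by
  have hsign := Literature.Barriers.BirchSwinnertonDyer.rootNumber_eq_neg_one_pow_order_padicLFunction_conductorLevel_anyPrime hord hF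
  obtain ⟨h0, h2⟩ := order_padicLFunction_eq_zero_or_two hp2 hord hF hc hL hlam
  have heven : Even (padicLFunction F (unitRoot W p : ℚ_[p])).order.toNat := by
    by_cases h1 : W.entireLFunction 1 = 0
    · rw [h2 h1]; decide
    · rw [h0 h1]; decide
  rw [heven.neg_one_pow] at hsign
  exact_mod_cast hsign

/-- ★ **`p ≥ 5`: NO CYCLOTOMIC TWIST VANISHES ON THE `λ_p = 2` STRATUM** (`φ(p^{n+1}) ≥ p − 1 ≥ 4 > 2 = λ`): `L(E, χ, 1) ≠ 0` for every
even primitive `p`-power-order `χ` of conductor `p^m`, every `m ≥ 2`, every continuation.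
[cite: RohrlichInventiones1984, Theorem (p. 409)] [cite: Washington1997, §7.1–7.2] -/
theorem twistedLValue_ne_zero_of_five_le (hp5 : 5 ≤ p) (hord : IsOrdinaryAt W p) (hf : IsNewformOf W f) {L : IwasawaAlgebra p}
    {c : ℚ_[p]} (hc : c ≠ 0) (hL : iwasawaToPowerSeries p L = PowerSeries.C c * padicLFunction f (unitRoot W p : ℚ_[p]))
    (hlam : lam L = 2) {m : ℕ} (hm : 2 ≤ m) (χ : DirichletCharacter ℂ (p ^ m)) (hχ : χ.IsPrimitive) (hχe : χ.Even)
    (hχo : ∃ j : ℕ, orderOf χ = p ^ j) {Lχ : ℂ → ℂ} (hLd : Differentiable ℂ Lχ)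
    (hLχ : ∀ s : ℂ, 2 < s.re → Lχ s = twistedLSeries f χ s) : Lχ 1 ≠ 0 := by
  refine twistedLValue_ne_zero_of_lam_lt (by omega) hord hf hc hL hm ?_ χ hχ hχe hχo hLd hLχ
  obtain ⟨k, hk⟩ : ∃ k, m - 1 = k + 1 := ⟨m - 2, by omega⟩
  rw [hlam, hk, Nat.totient_prime_pow_succ hp.out]
  calc 2 < p - 1 := by omega
    _ = p ^ 0 * (p - 1) := by rw [pow_zero, one_mul]
    _ ≤ p ^ k * (p - 1) := Nat.mul_le_mul_right _ (Nat.pow_le_pow_right hp.out.pos (Nat.zero_le k))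

/-- **`p = 3`, conductor `≥ 27` never vanishes on the `λ₃ = 2` stratum** (`φ(3^{m−1}) = 2·3^{m−2} ≥ 6 > 2` for `m ≥ 3`).
[cite: RohrlichInventiones1984, Theorem (p. 409)] [cite: Washington1997, §7.1–7.2] -/
theorem twistedLValue_ne_zero_of_conductor_ge_twentyseven {W : WeierstrassCurve ℚ} [W.IsElliptic] [W.IsGloballyMinimal]
    {N : ℕ} [NeZero N] {f : CuspForm (Gamma0 N) 2} (hord : IsOrdinaryAt W 3) (hf : IsNewformOf W f) {L : IwasawaAlgebra 3}
    {c : ℚ_[3]} (hc : c ≠ 0) (hL : iwasawaToPowerSeries 3 L = PowerSeries.C c * padicLFunction f (unitRoot W 3 : ℚ_[3]))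
    (hlam : lam L = 2) {m : ℕ} (hm : 3 ≤ m) (χ : DirichletCharacter ℂ (3 ^ m)) (hχ : χ.IsPrimitive) (hχe : χ.Even)
    (hχo : ∃ j : ℕ, orderOf χ = 3 ^ j) {Lχ : ℂ → ℂ} (hLd : Differentiable ℂ Lχ)
    (hLχ : ∀ s : ℂ, 2 < s.re → Lχ s = twistedLSeries f χ s) : Lχ 1 ≠ 0 := by
  refine twistedLValue_ne_zero_of_lam_lt (by norm_num) hord hf hc hL (by omega) ?_ χ hχ hχe hχo hLd hLχ
  obtain ⟨k, hk⟩ : ∃ k, m - 1 = k + 1 := ⟨m - 2, by omega⟩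
  rw [hlam, hk, Nat.totient_prime_pow_succ (by norm_num : Nat.Prime 3)]
  calc 2 < 3 ^ 1 * (3 - 1) := by norm_num
    _ ≤ 3 ^ k * (3 - 1) := Nat.mul_le_mul_right _ (Nat.pow_le_pow_right (by norm_num) (by omega))

/-- `Φ₃(1+T) = T² + 3T + 3 = T² + 3(T+1)` in `Λ₃`. [folklore] -/
theorem coe_cyclotomic_three_comp {j : ℕ} (hj : j = 1) :
    ((((Polynomial.cyclotomic (3 ^ j) ℤ_[3]).comp (Polynomial.X + 1) : Polynomial ℤ_[3])) : IwasawaAlgebra 3) =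
      X ^ 2 + C (3 : ℤ_[3]) * X + C (3 : ℤ_[3]) := by
  subst hj
  rw [pow_one, Polynomial.cyclotomic_three]
  simp only [Polynomial.add_comp, Polynomial.pow_comp, Polynomial.X_comp, Polynomial.one_comp, Polynomial.coe_add,
    Polynomial.coe_pow, Polynomial.coe_X, Polynomial.coe_one, map_ofNat]
  ring

/-- `T² + 3T + 3` is prime in `Λ₃` and divides no `3^k`. [cite: Washington1997, §7.1, §13.2] -/
theorem prime_three_layer :
    Prime (X ^ 2 + C (3 : ℤ_[3]) * X + C (3 : ℤ_[3]) : IwasawaAlgebra 3) ∧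
      ∀ k : ℕ, ¬ (X ^ 2 + C (3 : ℤ_[3]) * X + C (3 : ℤ_[3]) : IwasawaAlgebra 3) ∣ C (((3 : ℕ) : ℤ_[3]) ^ k) := by
  have h1 := prime_coe_cyclotomic_comp 3 0
  have h2 := not_cyclotomic_comp_dvd_C_pow (p := 3) 0
  rw [coe_cyclotomic_three_comp (zero_add 1)] at h1 h2
  exact ⟨h1, h2⟩

/-- ★ **`p = 3`, conductor `9`: `L(E, χ₉, 1) = 0 ⟺ a = 3`** for `pfree L = (T² + a(T+1))·U` on the `λ₃ = 2` stratum (`χ₉` either even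
primitive character mod `9` of order `3`; `Φ₃(1+T) = T² + 3(T+1)` is the member `a = 3` of the family; rigidity of the normal form).
[cite: MazurTateTeitelbaum1986Invent, §I.14 (14.3)] [cite: Washington1997, §7.1 Thm. 7.3, §7.2] -/
theorem twistedLValue_nine_eq_zero_iff {W : WeierstrassCurve ℚ} [W.IsElliptic] [W.IsGloballyMinimal]
    {N : ℕ} [NeZero N] {f : CuspForm (Gamma0 N) 2} (hord : IsOrdinaryAt W 3) (hf : IsNewformOf W f) {L : IwasawaAlgebra 3}
    {c : ℚ_[3]} (hc : c ≠ 0) (hL : iwasawaToPowerSeries 3 L = PowerSeries.C c * padicLFunction f (unitRoot W 3 : ℚ_[3]))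
    {a : ℤ_[3]} {U : ℤ_[3]⟦X⟧} (ha : a ∈ IsLocalRing.maximalIdeal ℤ_[3]) (hfac : pfree L = (X ^ 2 + C a * (X + 1)) * U)
    (hU : IsUnit U) (χ : DirichletCharacter ℂ (3 ^ 2)) (hχ : χ.IsPrimitive) (hχe : χ.Even)
    (hχo : ∃ j : ℕ, orderOf χ = 3 ^ j) {Lχ : ℂ → ℂ} (hLd : Differentiable ℂ Lχ)
    (hLχ : ∀ s : ℂ, 2 < s.re → Lχ s = twistedLSeries f χ s) : Lχ 1 = 0 ↔ a = 3 := by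
  have h3 : (3 : ℤ_[3]) ∈ IsLocalRing.maximalIdeal ℤ_[3] := by
    rw [PadicInt.maximalIdeal_eq_span_p, Ideal.mem_span_singleton, Nat.cast_ofNat]
  have hfac' : pfree L = (X ^ 2 + C a * X + C a) * U := by rw [hfac]; ring
  rw [twistedLValue_eq_zero_iff_dvd (by norm_num) hord hf hc hL (le_refl 2) χ hχ hχe hχo hLd hLχ,
    coe_cyclotomic_three_comp (by norm_num : 2 - 1 = 1), dvd_iff_dvd_pfree prime_three_layer.1 prime_three_layer.2 L]
  constructor
  · intro h
    exact (eq_of_quadratic_dvd_normalForm ha ha h3 h3 hfac' hU h).1.symm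
  · rintro rfl
    rw [hfac']
    exact dvd_mul_right _ _

/-- ★★ **MUTUAL EXCLUSION AT `p = 3`**: on the `λ₃ = 2` stratum (`E` good ordinary at `3`), **`L(E,1) = 0 ⟹ L(E, χ₉, 1) ≠ 0`** for both
even primitive characters `χ₉` mod `9` — together with `twistedLValue_ne_zero_of_conductor_ge_twentyseven`: A CENTRAL ZERO FORBIDS
EVERY CYCLOTOMIC-TWIST ZERO, and then `ord_T L₃(E,T) = 2` exactly (`order_padicLFunction_eq_zero_or_two`).  B1: `L`-values only.
[cite: MazurTateTeitelbaum1986Invent, §I.14, §I.17] [cite: Washington1997, §7.1] -/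
theorem three_mutualExclusion {W : WeierstrassCurve ℚ} [W.IsElliptic] [W.IsGloballyMinimal]
    {N : ℕ} [NeZero N] {f : CuspForm (Gamma0 N) 2} (hord : IsOrdinaryAt W 3) (hf : IsNewformOf W f) {L : IwasawaAlgebra 3}
    {c : ℚ_[3]} (hc : c ≠ 0) (hL : iwasawaToPowerSeries 3 L = PowerSeries.C c * padicLFunction f (unitRoot W 3 : ℚ_[3]))
    (hlam : lam L = 2) (hL1 : W.entireLFunction 1 = 0) (χ : DirichletCharacter ℂ (3 ^ 2)) (hχ : χ.IsPrimitive)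
    (hχe : χ.Even) (hχo : ∃ j : ℕ, orderOf χ = 3 ^ j) {Lχ : ℂ → ℂ} (hLd : Differentiable ℂ Lχ)
    (hLχ : ∀ s : ℂ, 2 < s.re → Lχ s = twistedLSeries f χ s) : Lχ 1 ≠ 0 := by
  obtain ⟨a, U, hU, ha, hfac⟩ := normalForm (by norm_num) hord hf hc hL hlam
  obtain rfl : a = 0 := (entireLFunction_one_eq_zero_iff hord hf hc hL hfac hU).mp hL1
  rw [Ne, twistedLValue_nine_eq_zero_iff hord hf hc hL ha hfac hU χ hχ hχe hχo hLd hLχ]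
  norm_num

end Elliptic

end Summit.BirchSwinnertonDyer.BirchSwinnertonDyer.Theorems.LambdaTransportDoorLambdaTwoStratumOddPrime

end
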